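import Summits.RiemannHypothesis.RiemannHypothesis.Theorems.HandoffDodgerFarCost
import HarnessLib

/-!
# HANDOFF — the COST SUM of the dodger over the unkilled zeros: near zeros by counting, far zeros by `HandoffDodgerFarCost` (rh-explicit, track «HANDOFF», seat prove-2 gen9, ATTEMPT-18 (D-4): Lemma C4 + C3 applied to the pointwise bound)

HONEST FRAMING. Nothing here bears on the truth of RH; this is zero COUNTING. The pointwise cost bound of ATTEMPT-18 (D-4)
(`HandoffDodgerPointwiseCost.pointwise_cost_le`) has the shape `A/γ² · exp(4S(γ)) · exp(−c/(γ+1)²)` at an unkilled zero of height `γ > T`,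
where `S(γ) = Σ_{k<K−1} 1/(γ − ℓ_{k+1})` obeys `S ≤ S_n := (b/π)(1 + log(K−1))` always and `S(γ) ≤ p/γ` (`p = 2(K−1)`) for `γ > 2T`
(`HandoffDodgerDenominators`), and `c = 4∫tD ≍ T³`. THIS FILE sums that shape over any finite set of zeros above the killing height, abstractly
in `S` (only the two bounds are assumed):

  `Σ_{ρ ∈ s} m(ρ)·A/γ_ρ²·e^{4S(γ_ρ)}·e^{−c/(γ_ρ+1)²} ≤ A·[ N(2T)/T²·e^{4S_n − c/(2T+1)²} + e^{144p²/(7c)}·( N(√(c/4))/(e·c/4) + B(0, √(c/4)) ) ]`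

(`cost_sum_le`; `T ≥ 2`, `c ≥ 64`, `A ≥ 0`): the NEAR zeros `T < γ ≤ 2T` by their count `N(2T)` (Lemma C4), the FAR zeros `γ > 2T` by
`exp(4p/γ − c/(γ+1)²) ≤ exp(144p²/(7c))·exp(−(c/4)/γ²)` (AM–GM) and the tree's `far_cost_le` (Lemma C3, crude constants). The bound is uniform
in `s`, as the zero-side domination requires. No `sorry`, standard axioms, no definitions.

References: this track (ATTEMPT-16 §4 Lemmas C3, C4; ATTEMPT-18 §1 (D-1), (D-4)).
-/

set_option linter.dupNamespace false

noncomputable section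

open Real Finset

namespace Summit.RiemannHypothesis.RiemannHypothesis.Theorems.Handoff

open Literature.NumberTheory.LFunctions Literature.NumberTheory.LFunctions.KadiriTail
  Literature.NumberTheory.LFunctions.SchoenfeldBound

/-- **AM–GM for the far exponent**: for `γ ≥ 2`, `c > 0` and any `p`:
`4p/γ − c/(γ+1)² ≤ 144p²/(7c) − (c/4)/γ²` (`(γ+1)² ≤ (9/4)γ²` and `Pu − ru² ≤ P²/(4r)`). [folklore] -/
theorem far_exponent_le {γ p c : ℝ} (hγ : 2 ≤ γ) (hc : 0 < c) :
    4 * p / γ - c / (γ + 1) ^ 2 ≤ 144 * p ^ 2 / (7 * c) - c / 4 / γ ^ 2 := by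
  have hγ0 : 0 < γ := by linarith
  have h1 : c / (γ + 1) ^ 2 ≥ 4 * c / 9 / γ ^ 2 := by
    rw [ge_iff_le, div_le_div_iff₀ (by positivity) (by positivity)]
    nlinarith [mul_pos hc hγ0]
  -- `4p/γ − (4c/9)/γ² + (c/4)/γ² = 4p u − (7c/36) u²  ≤ 144p²/(7c)` with `u = 1/γ`
  set u : ℝ := 1 / γ with hu
  have hu0 : 0 ≤ u := by positivity
  have e1 : 4 * p / γ = 4 * p * u := by rw [hu]; ring
  have e2 : 4 * c / 9 / γ ^ 2 = 4 * c / 9 * u ^ 2 := by rw [hu]; field_simp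
  have e3 : c / 4 / γ ^ 2 = c / 4 * u ^ 2 := by rw [hu]; field_simp
  have key : 4 * p * u - 4 * c / 9 * u ^ 2 + c / 4 * u ^ 2 ≤ 144 * p ^ 2 / (7 * c) := by
    have h2 : 4 * p * u - 4 * c / 9 * u ^ 2 + c / 4 * u ^ 2 = 4 * p * u - 7 * c / 36 * u ^ 2 := by ring
    rw [h2]
    rw [le_div_iff₀ (by positivity)]
    nlinarith [sq_nonneg (72 * p - 7 * c * u), hc]
  linarith [h1, key, e1, e2, e3]

/-- **ATTEMPT-18 (D-4): the cost sum (kernel).** See the module docstring. [this track, ATTEMPT-16 Lemmas C3/C4; ATTEMPT-18 (D-4)] -/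
theorem cost_sum_le {T c A p Sn : ℝ} (hT : 2 ≤ T) (hc : 64 ≤ c) (hA : 0 ≤ A)
    {S : ℝ → ℝ} (hSn : ∀ γ : ℝ, T < γ → γ ≤ 2 * T → S γ ≤ Sn) (hSf : ∀ γ : ℝ, 2 * T < γ → S γ ≤ p / γ)
    (s : Finset ℂ) (hs : ∀ ρ ∈ s, riemannZeta ρ = 0 ∧ 0 ≤ ρ.re ∧ ρ.re ≤ 1 ∧ T < ρ.im) :
    ∑ ρ ∈ s, (riemannZetaZeroOrder ρ : ℝ) * (A / ρ.im ^ 2 * Real.exp (4 * S ρ.im) * Real.exp (-c / (ρ.im + 1) ^ 2)) ≤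
      A * ((zetaZeroCount (2 * T) : ℝ) / T ^ 2 * Real.exp (4 * Sn - c / (2 * T + 1) ^ 2) +
        Real.exp (144 * p ^ 2 / (7 * c)) *
          ((zetaZeroCount (Real.sqrt (c / 4)) : ℝ) / (Real.exp 1 * (c / 4)) + tailBound |(0 : ℝ)| (Real.sqrt (c / 4)))) := by
  classical
  have hc0 : 0 < c := by linarith
  have hT0 : 0 < T := by linarith
  have hm0 : ∀ ρ ∈ s, (0 : ℝ) ≤ riemannZetaZeroOrder ρ := fun ρ hρ ↦ by
    obtain ⟨hz, -, -, him⟩ := hs ρ hρ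
    exact_mod_cast zero_le_one.trans (ZetaZeros.riemannZetaNontrivialZeros.one_le_order
      (ZetaZeros.riemannZetaNontrivialZeros.mem_of_im_ne_zero hz (by linarith : ρ.im ≠ 0)))
  set s₁ : Finset ℂ := s.filter (fun ρ ↦ ρ.im ≤ 2 * T) with hs₁
  set s₂ : Finset ℂ := s.filter (fun ρ ↦ ¬ ρ.im ≤ 2 * T) with hs₂
  rw [← sum_filter_add_sum_filter_not s (fun ρ ↦ ρ.im ≤ 2 * T), mul_add]
  refine add_le_add ?_ ?_
  · -- NEAR: `T < γ ≤ 2T`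
    have hterm : ∀ ρ ∈ s₁, (riemannZetaZeroOrder ρ : ℝ) * (A / ρ.im ^ 2 * Real.exp (4 * S ρ.im) * Real.exp (-c / (ρ.im + 1) ^ 2)) ≤
        (riemannZetaZeroOrder ρ : ℝ) * (A / T ^ 2 * Real.exp (4 * Sn - c / (2 * T + 1) ^ 2)) := by
      intro ρ hρ
      obtain ⟨hρs, hle⟩ := mem_filter.1 hρ
      obtain ⟨-, -, -, hγ⟩ := hs ρ hρs
      refine mul_le_mul_of_nonneg_left ?_ (hm0 ρ hρs)
      have h1 : A / ρ.im ^ 2 ≤ A / T ^ 2 :=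
        div_le_div_of_nonneg_left hA (by positivity) (pow_le_pow_left₀ hT0.le hγ.le 2)
      have h2 : Real.exp (4 * S ρ.im) * Real.exp (-c / (ρ.im + 1) ^ 2) ≤ Real.exp (4 * Sn - c / (2 * T + 1) ^ 2) := by
        rw [← Real.exp_add]
        refine Real.exp_le_exp.2 ?_
        have h3 := hSn ρ.im hγ hle
        have hγ1 : 0 < ρ.im + 1 := by linarith
        have h4 : c / (2 * T + 1) ^ 2 ≤ c / (ρ.im + 1) ^ 2 :=
          div_le_div_of_nonneg_left hc0.le (pow_pos hγ1 2) (pow_le_pow_left₀ hγ1.le (by linarith) 2)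
        rw [neg_div]
        linarith
      calc A / ρ.im ^ 2 * Real.exp (4 * S ρ.im) * Real.exp (-c / (ρ.im + 1) ^ 2)
          = A / ρ.im ^ 2 * (Real.exp (4 * S ρ.im) * Real.exp (-c / (ρ.im + 1) ^ 2)) := by ring
        _ ≤ A / T ^ 2 * Real.exp (4 * Sn - c / (2 * T + 1) ^ 2) :=
            mul_le_mul h1 h2 (by positivity) (by positivity)
    refine (sum_le_sum hterm).trans ?_
    rw [← sum_mul]
    have hcount : ∑ ρ ∈ s₁, (riemannZetaZeroOrder ρ : ℝ) ≤ zetaZeroCount (2 * T) :=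
      sum_zeroOrder_le_zetaZeroCount (by linarith) s₁ fun ρ hρ ↦ by
        obtain ⟨hρs, hle⟩ := mem_filter.1 hρ
        obtain ⟨hz, h1, h2, hγ⟩ := hs ρ hρs
        exact ⟨hz, h1, h2, by linarith, hle⟩
    have : (∑ ρ ∈ s₁, (riemannZetaZeroOrder ρ : ℝ)) * (A / T ^ 2 * Real.exp (4 * Sn - c / (2 * T + 1) ^ 2)) ≤
        (zetaZeroCount (2 * T) : ℝ) * (A / T ^ 2 * Real.exp (4 * Sn - c / (2 * T + 1) ^ 2)) :=
      mul_le_mul_of_nonneg_right hcount (by positivity)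
    refine this.trans (le_of_eq ?_)
    ring
  · -- FAR: `γ > 2T`
    have ha16 : 16 ≤ c / 4 := by linarith
    have hterm : ∀ ρ ∈ s₂, (riemannZetaZeroOrder ρ : ℝ) * (A / ρ.im ^ 2 * Real.exp (4 * S ρ.im) * Real.exp (-c / (ρ.im + 1) ^ 2)) ≤
        A * Real.exp (144 * p ^ 2 / (7 * c)) *
          ((riemannZetaZeroOrder ρ : ℝ) * (Real.exp (-(c / 4) / ρ.im ^ 2) / ρ.im ^ 2)) := by
      intro ρ hρ
      obtain ⟨hρs, hgt⟩ := mem_filter.1 hρ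
      have hγ2T : 2 * T < ρ.im := lt_of_not_ge hgt
      have hγ2 : 2 ≤ ρ.im := by linarith
      have hγ0 : 0 < ρ.im := by linarith
      have hexp : Real.exp (4 * S ρ.im) * Real.exp (-c / (ρ.im + 1) ^ 2) ≤
          Real.exp (144 * p ^ 2 / (7 * c)) * Real.exp (-(c / 4) / ρ.im ^ 2) := by
        rw [← Real.exp_add, ← Real.exp_add]
        refine Real.exp_le_exp.2 ?_
        have h1 : 4 * S ρ.im ≤ 4 * p / ρ.im := by
          have := hSf ρ.im hγ2T
          rw [mul_div_assoc]
          linarith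
        have h2 := far_exponent_le (p := p) hγ2 hc0
        rw [neg_div, neg_div]
        linarith
      have e : (riemannZetaZeroOrder ρ : ℝ) * (A / ρ.im ^ 2 * Real.exp (4 * S ρ.im) * Real.exp (-c / (ρ.im + 1) ^ 2)) =
          (riemannZetaZeroOrder ρ : ℝ) * (A / ρ.im ^ 2) * (Real.exp (4 * S ρ.im) * Real.exp (-c / (ρ.im + 1) ^ 2)) := by ring
      rw [e]
      calc (riemannZetaZeroOrder ρ : ℝ) * (A / ρ.im ^ 2) * (Real.exp (4 * S ρ.im) * Real.exp (-c / (ρ.im + 1) ^ 2))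
          ≤ (riemannZetaZeroOrder ρ : ℝ) * (A / ρ.im ^ 2) * (Real.exp (144 * p ^ 2 / (7 * c)) * Real.exp (-(c / 4) / ρ.im ^ 2)) :=
            mul_le_mul_of_nonneg_left hexp (mul_nonneg (hm0 ρ hρs) (by positivity))
        _ = A * Real.exp (144 * p ^ 2 / (7 * c)) *
              ((riemannZetaZeroOrder ρ : ℝ) * (Real.exp (-(c / 4) / ρ.im ^ 2) / ρ.im ^ 2)) := by ring
    refine (sum_le_sum hterm).trans ?_
    rw [← mul_sum]
    have hfar := far_cost_le ha16 s₂ fun ρ hρ ↦ by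
      obtain ⟨hρs, hgt⟩ := mem_filter.1 hρ
      obtain ⟨hz, h1, h2, hγ⟩ := hs ρ hρs
      exact ⟨hz, h1, h2, by linarith⟩
    have hAE : 0 ≤ A * Real.exp (144 * p ^ 2 / (7 * c)) := mul_nonneg hA (Real.exp_pos _).le
    calc A * Real.exp (144 * p ^ 2 / (7 * c)) *
          ∑ ρ ∈ s₂, (riemannZetaZeroOrder ρ : ℝ) * (Real.exp (-(c / 4) / ρ.im ^ 2) / ρ.im ^ 2)
        ≤ A * Real.exp (144 * p ^ 2 / (7 * c)) *
          ((zetaZeroCount (Real.sqrt (c / 4)) : ℝ) / (Real.exp 1 * (c / 4)) + tailBound |(0 : ℝ)| (Real.sqrt (c / 4))) :=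
          mul_le_mul_of_nonneg_left hfar hAE
      _ = A * (Real.exp (144 * p ^ 2 / (7 * c)) *
          ((zetaZeroCount (Real.sqrt (c / 4)) : ℝ) / (Real.exp 1 * (c / 4)) + tailBound |(0 : ℝ)| (Real.sqrt (c / 4)))) := by ring

end Summit.RiemannHypothesis.RiemannHypothesis.Theorems.Handoff

end
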